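import Mathlib
import Summits.Ventures.PercRepro2.UniversalDoubleBundleSP
import Summits.Ventures.PercRepro2.UniversalSeriesBundles

/-! # (UH*) on every series of bundles, on the cell's own SP terms
(seat mine-b, cell pub-perc-repro2; MINE-B.md §24)

The term `SP.seriesBundles n m = bundle (m 0) ∧ (bundle (m 1) ∧ (… ∧ bundle (m n)))` has the
configuration type `(bundle (m 0)).Conf × ((bundle (m 1)).Conf × …)`; `sbIso` identifies it, bundle
by bundle (`bundleIso`, then `Fin.consOrderIso`), with the dependent cube `SBConf m` of
SeriesBundlesDefs.lean, and the labels are `sbR` / `sbB` along the identification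
(`SP.rLab_seriesBundles`, `SP.bLab_seriesBundles`: the series label is the minimum over the bundles).
`universal_transport` carries `universal_seriesBundles` over: **`SP.universal_seriesBundles`**, (UH*) on
every series of bundles with all bundles of `≥ 3` edges, as a statement about the SP terms. -/

namespace Summit.Ventures.PercRepro2.V2Closure

open Finset
open Summit.Ventures.PercRepro2.UHClosure

/-- the series of bundles `bundle (m 0) ∧ (bundle (m 1) ∧ … ∧ bundle (m n))` -/
def SP.seriesBundles : (n : ℕ) → (Fin (n + 1) → ℕ) → SP
  | 0, m => SP.bundle (m 0)
  | n + 1, m => SP.ser (SP.bundle (m 0)) (SP.seriesBundles n (fun j => m j.succ))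

/-- a family indexed by `Fin 1` is its value at `0` -/
def piFinOneIso (α : Fin 1 → Type*) [∀ i, Preorder (α i)] : (∀ i, α i) ≃o α 0 where
  toEquiv := Equiv.piUnique α
  map_rel_iff' := by
    intro f g
    simp only [Equiv.piUnique_apply, Pi.le_def, Unique.forall_iff]

/-- the product of two order isomorphisms -/
def prodIso {A B C D : Type*} [Preorder A] [Preorder B] [Preorder C] [Preorder D]
    (e : A ≃o B) (f : C ≃o D) : A × C ≃o B × D where
  toFun p := (e p.1, f p.2)
  invFun q := (e.symm q.1, f.symm q.2)
  left_inv p := by simp only [OrderIso.symm_apply_apply]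
  right_inv q := by simp only [OrderIso.apply_symm_apply]
  map_rel_iff' := by
    intro p q
    simp only [Equiv.coe_fn_mk, Prod.le_def, OrderIso.le_iff_le]

/-- the configuration cube of the series-of-bundles term, bundle by bundle -/
def sbIso : ∀ (n : ℕ) (m : Fin (n + 1) → ℕ), (SP.seriesBundles n m).Conf ≃o SBConf m
  | 0, m => (bundleIso (m 0)).trans (piFinOneIso (fun t => Finset (Fin (m t)))).symm
  | n + 1, m =>
      (prodIso (bundleIso (m 0)) (sbIso n (fun j => m j.succ))).trans
        (Fin.consOrderIso (fun t => Finset (Fin (m t))))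

/-- the identification at `n = 0` -/
theorem sbIso_zero_apply (m : Fin 1 → ℕ) (c : (SP.seriesBundles 0 m).Conf) :
    sbIso 0 m c 0 = bundleIso (m 0) c := by
  change uniqueElim (α := fun t : Fin 1 => Finset (Fin (m t))) (bundleIso (m 0) c) (default : Fin 1) =
    bundleIso (m 0) c
  exact uniqueElim_default _

/-- the identification at `n + 1`, first bundle -/
theorem sbIso_succ_apply_zero (n : ℕ) (m : Fin (n + 2) → ℕ)
    (c : (SP.seriesBundles (n + 1) m).Conf) : sbIso (n + 1) m c 0 = bundleIso (m 0) c.1 := by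
  change Fin.cons (α := fun t => Finset (Fin (m t))) (bundleIso (m 0) c.1)
    (sbIso n (fun j => m j.succ) c.2) 0 = _
  exact Fin.cons_zero _ _

/-- the identification at `n + 1`, later bundles -/
theorem sbIso_succ_apply_succ (n : ℕ) (m : Fin (n + 2) → ℕ)
    (c : (SP.seriesBundles (n + 1) m).Conf) (j : Fin (n + 1)) :
    sbIso (n + 1) m c j.succ = sbIso n (fun j => m j.succ) c.2 j := by
  change Fin.cons (α := fun t => Finset (Fin (m t))) (bundleIso (m 0) c.1)
    (sbIso n (fun j => m j.succ) c.2) j.succ = _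
  exact Fin.cons_succ _ _ _

/-- the red label over one bundle -/
theorem sbR_one (m : Fin 1 → ℕ) (x : SBConf m) : sbR m x = m 0 - (x 0).card := by
  apply le_antisymm (sbR_le x 0)
  apply le_sbR
  intro t
  obtain rfl := Fin.fin_one_eq_zero t
  exact le_rfl

/-- the blue label over one bundle -/
theorem sbB_one (m : Fin 1 → ℕ) (x : SBConf m) : sbB m x = (x 0).card := by
  apply le_antisymm (sbB_le x 0)
  apply le_sbB
  intro t
  obtain rfl := Fin.fin_one_eq_zero t
  exact le_rfl

/-- the red label splits off the first bundle -/
theorem sbR_cons (n : ℕ) (m : Fin (n + 2) → ℕ) (x : SBConf m) :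
    sbR m x = min (m 0 - (x 0).card) (sbR (fun j => m j.succ) (fun j => x j.succ)) := by
  apply le_antisymm
  · exact le_min (sbR_le x 0) (le_sbR (fun j => sbR_le x j.succ))
  · apply le_sbR
    intro t
    refine Fin.cases ?_ (fun j => ?_) t
    · exact min_le_left _ _
    · exact le_trans (min_le_right _ _) (sbR_le (m := fun j => m j.succ) (fun j => x j.succ) j)

/-- the blue label splits off the first bundle -/
theorem sbB_cons (n : ℕ) (m : Fin (n + 2) → ℕ) (x : SBConf m) :
    sbB m x = min (x 0).card (sbB (fun j => m j.succ) (fun j => x j.succ)) := by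
  apply le_antisymm
  · exact le_min (sbB_le x 0) (le_sbB (fun j => sbB_le x j.succ))
  · apply le_sbB
    intro t
    refine Fin.cases ?_ (fun j => ?_) t
    · exact min_le_left _ _
    · exact le_trans (min_le_right _ _) (sbB_le (m := fun j => m j.succ) (fun j => x j.succ) j)

/-- the red label of the series-of-bundles term is `sbR` along the identification -/
theorem SP.rLab_seriesBundles : ∀ (n : ℕ) (m : Fin (n + 1) → ℕ) (c : (SP.seriesBundles n m).Conf),
    (SP.seriesBundles n m).rLab c = sbR m (sbIso n m c)
  | 0, m, c => by
      rw [sbR_one, sbIso_zero_apply, card_bundleIso]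
      exact SP.bundle_rLab (m 0) c
  | n + 1, m, c => by
      obtain ⟨c₁, c₂⟩ := c
      show min ((SP.bundle (m 0)).rLab c₁) ((SP.seriesBundles n (fun j => m j.succ)).rLab c₂) = _
      rw [sbR_cons, SP.bundle_rLab, SP.rLab_seriesBundles n (fun j => m j.succ) c₂]
      simp only [sbIso_succ_apply_zero, sbIso_succ_apply_succ, card_bundleIso]

/-- the blue label of the series-of-bundles term is `sbB` along the identification -/
theorem SP.bLab_seriesBundles : ∀ (n : ℕ) (m : Fin (n + 1) → ℕ) (c : (SP.seriesBundles n m).Conf),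
    (SP.seriesBundles n m).bLab c = sbB m (sbIso n m c)
  | 0, m, c => by
      rw [sbB_one, sbIso_zero_apply, card_bundleIso]
      exact SP.bundle_bLab (m 0) c
  | n + 1, m, c => by
      obtain ⟨c₁, c₂⟩ := c
      show min ((SP.bundle (m 0)).bLab c₁) ((SP.seriesBundles n (fun j => m j.succ)).bLab c₂) = _
      rw [sbB_cons, SP.bundle_bLab, SP.bLab_seriesBundles n (fun j => m j.succ) c₂]
      simp only [sbIso_succ_apply_zero, sbIso_succ_apply_succ, card_bundleIso]

/-- **THEOREM: (UH*) holds on every series of bundles `bundle (m 0) ∧ … ∧ bundle (m n)` with all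
bundles of `≥ 3` edges, on the SP terms.** -/
theorem SP.universal_seriesBundles (n : ℕ) (m : Fin (n + 1) → ℕ) (hm : ∀ t, 3 ≤ m t) :
    Universal (SP.seriesBundles n m).rLab (SP.seriesBundles n m).bLab := by
  have hr : (SP.seriesBundles n m).rLab = sbR m ∘ (sbIso n m).symm.symm := by
    funext c; exact SP.rLab_seriesBundles n m c
  have hb : (SP.seriesBundles n m).bLab = sbB m ∘ (sbIso n m).symm.symm := by
    funext c; exact SP.bLab_seriesBundles n m c
  rw [hr, hb]
  exact universal_transport (sbIso n m).symm _ _ (UHClosure.universal_seriesBundles hm)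

end Summit.Ventures.PercRepro2.V2Closure
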